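import Summits.BirchSwinnertonDyer.BirchSwinnertonDyer.Theorems.KimAtThreeD7uTamagawaSharp
import HarnessLib

/-!
# The TAMAGAWA-DIVISIBLE bad places, XX: two-level inputs for the WHOLE TOWER — `𝓕_can` is cartesian along
# EVERY inclusion `E[p^j·p] ↪ E[p^k·p]`, the short exact sequence `0 → E[p^j·p] → E[p^{j+n+1}·p] → E[p^n·p] → 0`
# on `H¹`, and local injectivity of `incl_*` at Kolyvagin primes
# (cell `bsd-addord`, seat w2-tamdiv gen 6; route W2 `KimAtThreeKolyvagin`, items 19562 / 19679 / 19599 /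
# 19560, «TamDiv∞» at Kolyvagin-system level)

HONEST FRAMING: TOOL theorems (no definition, no named fact, no `sorry`); closes nothing by itself;
nothing is booked; BSD is not proved by any of this.  Every prime `p`, every place, no hypothesis beyond
the displayed ones.

## Why

Parts XVIII–XIX identify `KS(E[3^{k+1}·3], 𝓕_u)` with `incl_* KS(E[3], 𝓕̄_can)` at the FIRST level past the
threshold `k + 1 = max_ℓ v₃(c_ℓ)`, using n1011-p11/p13/p15's inputs for the pair `E[3] ↪ E[3^{k+1}·3]`.  To run
the same lift at EVERY level past the threshold (part XXI: `KS(E[3^{j+n+1}·3], 𝓕_u) = incl_* KS(E[3^j·3], 𝓕_can)`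
whenever `n + 1 = max_ℓ v₃(c_ℓ)`) one needs those inputs for a general sub-level `j`:

* §1 **`mem_propagatedSelmerStructure_of_localMap_torsionInclusion_mem`** (every `p`, `j ≤ k`, every place
  `v`): `𝓕_can` is CARTESIAN along `incl : E[p^j·p] ↪ E[p^k·p]` — `incl_* x ∈ 𝓕_can(v)` on `E[p^k·p]` ⇒
  `x ∈ 𝓕_can(v)` on `E[p^j·p]` (n1011-p13's cocycle proof for `j = 0`, with the shift `η / p^{k-j}`).
* §2 (every `p`, levels `j`, `j+n+1`, `n`; `red` any equivariant map acting as `x ↦ p^{j+1} x`)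
  `isSES_torsionInclusion_red_add`, `exists_map_torsionInclusion_eq_of_map_red_eq_zero_add` (exactness on
  `H¹`), `localMap_torsionInclusion_injective_add` (local injectivity of `incl_*` at a prime with cyclic
  invariants of orders `p^{j+n+2}`, `p^{n+1}`, `p^{j+1}` — a Kolyvagin prime of level `p^{j+n+2}`),
  `exists_bases_red_top_to_sub` (matched bases for the comparison-map reflection along `incl`).
n1011-p11 GEN 6 (`TorsionLevelDevissageHigher`) is the case `j = 0`, `p = 3` of all of these.

References: R. Sakamoto, JTNB 36 (2024) Def. 3.5; B. Mazur, K. Rubin, Mem. AMS 799 (2004) Lemma 3.7.1;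
K. Rubin, PCMI 18 (2011) Prop. 1.4.13; J. S. Milne, *ADT* I §6; J.-P. Serre, *Galois Cohomology* I §2.2.
-/

noncomputable section

-- the cell's Theorems namespace `Summit.BirchSwinnertonDyer.BirchSwinnertonDyer.…` repeats the summit name by design (D-0017)
set_option linter.dupNamespace false

open scoped Classical NumberField ContRepresentation
open Function Field NumberField IsDedekindDomain Module
open WeierstrassCurve Literature.NumberTheory.EllipticCurves Literature.NumberTheory.GaloisRepresentations
  Literature.NumberTheory.GaloisRepresentations.DiscreteGaloisModule Literature.NumberTheory.GaloisCohomology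
open Summit.BirchSwinnertonDyer.Rank1Residual Summit.BirchSwinnertonDyer.Rank1Residual.GaloisImage

namespace Summit.BirchSwinnertonDyer.BirchSwinnertonDyer.Theorems.KimAtThreeD7uTamagawaSharp

/-! ### §1 `𝓕_can` is cartesian along EVERY inclusion `E[p^j·p] ↪ E[p^k·p]` (every `p`, every place) -/

section Cartesian

variable (W : WeierstrassCurve ℚ) [W.IsElliptic] (p : ℕ) [hp : Fact p.Prime] {j k : ℕ}

/-- **`𝓕_can` is cartesian along `incl : E[p^j·p] ↪ E[p^k·p]` at every place** (`j ≤ k`, every prime `p`,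
every place `v` of `ℚ`, every reduction type, no hypothesis): a class `x ∈ H¹(ℚ_v, E[p^j·p])` whose image
`incl_* x` lies in `𝓕_can(v) = π_{k+1,*} H¹(ℚ_v, T_pE)` on `E[p^k·p]` already lies in `𝓕_can(v) = π_{j+1,*}
H¹(ℚ_v, T_pE)` on `E[p^j·p]`.  n1011-p13's cocycle proof (`isCartesianAt_propagatedSelmerStructure`, the case
`j = 0`) one notch up: write `incl ∘ ξ = π_{k+1} ∘ η + ∂t`, lift `t` to `T_pE` and absorb `∂t̃` into `η`; then
`π_{k+1} ∘ η = incl ∘ ξ` takes values in `E[p^k·p][p^{j+1}] = π_{k+1}(p^{k-j} T_pE)`, so `η` takes values in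
`p^{k-j} T_pE` and `η / p^{k-j}` (the shift `tateDivPow (k - j)`) is a continuous crossed homomorphism with
`π_{j+1} ∘ (η / p^{k-j}) = ξ`. [cite: Sakamoto2024, Def. 3.5 (p. 923)] [cite: MazurRubin2004, Lemma 3.7.1] -/
theorem mem_propagatedSelmerStructure_of_localMap_torsionInclusion_mem (hjk : j ≤ k) (v : Place ℚ)
    (x : galoisCohomology ((W.torsionGaloisModule ((p : ℤ) ^ j * (p : ℤ))).toLocal v) 1)
    (hx : localMap (W.torsionInclusion (pow_mul_dvd_pow_mul_of_le p hjk)) v x ∈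
      propagatedSelmerStructure W p k v) :
    x ∈ propagatedSelmerStructure W p j v := by
  set incl := W.torsionInclusion (pow_mul_dvd_pow_mul_of_le p hjk) with hincl
  obtain ⟨ξ, hξ⟩ := oneCocycleClass_surjective
    ((W.torsionGaloisModule ((p : ℤ) ^ j * (p : ℤ))).toLocal v).toTopRep x
  subst hξ
  obtain ⟨y, hy⟩ := (mem_propagatedSelmerStructure_iff W p k v _).mp hx
  obtain ⟨η, hη⟩ := oneCocycleClass_surjective (tateLocalRep W p v).toTopRep y
  subst hη
  -- `incl_* [ξ] = [incl ∘ ξ]`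
  set ξ' := contOneCocycles.pullback (ContinuousMonoidHom.id _)
    (X := ((W.torsionGaloisModule ((p : ℤ) ^ j * (p : ℤ))).toLocal v).toTopRep)
    (Y := ((W.torsionGaloisModule ((p : ℤ) ^ k * (p : ℤ))).toLocal v).toTopRep)
    (TopRep.ofHom ⟨(incl.restrictField (Place.Completion v)).toContinuousLinearMap,
      (incl.restrictField (Place.Completion v)).isIntertwining'⟩) ξ with hξ'_def
  have hloc : localMap incl v (oneCocycleClass _ ξ) = oneCocycleClass _ ξ' :=
    galoisCohomology.map_one_oneCocycleClass _ ξ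
  have hξ'app : ∀ g, ((ξ'.1 g : geomTorsion W ((p : ℤ) ^ k * (p : ℤ))) : geomPoints W) =
      ((ξ.1 g : geomTorsion W ((p : ℤ) ^ j * (p : ℤ))) : geomPoints W) := fun g => rfl
  rw [tateLocalMap_oneCocycleClass, hloc] at hy
  obtain ⟨t, ht⟩ := exists_sub_eq_of_oneCocycleClass_eq _ _ _ hy
  -- on underlying points: `(η g)_{k+1} - ξ g = g t - t`
  have ht' : ∀ g : absoluteGaloisGroup (Place.Completion v),
      TateModule.proj p (k + 1) (η.1 g) - ((ξ.1 g : geomTorsion W ((p : ℤ) ^ j * (p : ℤ))) : geomPoints W) =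
        absGaloisRestrict ℚ (Place.Completion v) g • (t : geomPoints W) - (t : geomPoints W) := by
    intro g
    exact congrArg (fun P : geomTorsion W ((p : ℤ) ^ k * (p : ℤ)) => (P : geomPoints W)) (ht g)
  -- lift `t` to `T_pE` and absorb its coboundary into `η`
  obtain ⟨tT, htT⟩ := proj_surjective_of_isAlgClosed_holds W p (k + 1)
    ((mem_geomTorsion_pow_mul_iff W p k _).mp t.2)
  set η' : contOneCocycles (tateLocalRep W p v).toTopRep :=
    η - principalCocycle _ tT (continuous_tateLocalRep_apply W p v tT) with hη'
  have hη'apply : ∀ g : absoluteGaloisGroup (Place.Completion v),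
      η'.1 g = η.1 g - ((tateLocalRep W p v).toTopRep.ρ g tT - tT) := fun g => rfl
  -- `(η' g)_{k+1} = ξ g`
  have hkey : ∀ g : absoluteGaloisGroup (Place.Completion v),
      TateModule.proj p (k + 1) (η'.1 g) = ((ξ.1 g : geomTorsion W ((p : ℤ) ^ j * (p : ℤ))) : geomPoints W) := by
    intro g
    rw [hη'apply, map_sub, map_sub, ContinuousRep.toTopRep_ρ_apply, tateLocalRep_apply_apply,
      TateModule.proj_smul_of_distribMulAction, htT, ← ht' g]
    abel
  -- hence `(η' g)_{k-j} = 0` (`p^{j+1}` kills `ξ g ∈ E[p^j·p]`)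
  have hk0 : ∀ g : absoluteGaloisGroup (Place.Completion v), TateModule.proj p (k - j) (η'.1 g) = 0 := by
    intro g
    rw [← TateModule.pow_smul_proj_self_add (j + 1) (k - j) (η'.1 g),
      show j + 1 + (k - j) = k + 1 by omega, hkey]
    have hmem := (mem_geomTorsion_iff W _ _).mp (ξ.1 g).2
    have h2 := congrArg (fun c : ℤ => c • ((ξ.1 g : geomTorsion W ((p : ℤ) ^ j * (p : ℤ))) : geomPoints W))
      (show ((p : ℤ) ^ j * (p : ℤ)) = ((p ^ (j + 1) : ℕ) : ℤ) by push_cast; ring)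
    simp only at h2
    rw [h2, natCast_zsmul] at hmem
    exact hmem
  -- the divided crossed homomorphism `η'' = η' / p^{k-j}`
  let f'' : absoluteGaloisGroup (Place.Completion v) → W.tateModule p :=
    fun g => tateDivPow (k - j) (η'.1 g) (hk0 g)
  have hf''val : ∀ (g : absoluteGaloisGroup (Place.Completion v)) (n : ℕ),
      TateModule.proj p n (f'' g) = TateModule.proj p (n + (k - j)) (η'.1 g) := fun g n => rfl
  have hcont'' : Continuous f'' :=
    continuous_induced_rng.2
      (continuous_pi fun n => (TateModule.continuous_proj (n + (k - j))).comp η'.1.continuous)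
  have hcoc'' : ∀ g h : absoluteGaloisGroup (Place.Completion v),
      f'' (g * h) = f'' g + (tateLocalRep W p v).toTopRep.ρ g (f'' h) := by
    intro g h
    apply TateModule.ext
    intro n
    rw [hf''val, map_add, hf''val, ContinuousRep.toTopRep_ρ_apply, tateLocalRep_apply_apply,
      TateModule.proj_smul_of_distribMulAction, hf''val, η'.2 g h, map_add,
      ContinuousRep.toTopRep_ρ_apply, tateLocalRep_apply_apply,
      TateModule.proj_smul_of_distribMulAction]
  let η'' : contOneCocycles (tateLocalRep W p v).toTopRep := ⟨⟨f'', hcont''⟩, hcoc''⟩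
  have hη''apply : ∀ g : absoluteGaloisGroup (Place.Completion v), η''.1 g = f'' g := fun g => rfl
  -- conclude: `x = [ξ] = π_{j+1,*} [η'']`
  refine (mem_propagatedSelmerStructure_iff W p j v _).mpr
    ⟨oneCocycleClass (tateLocalRep W p v).toTopRep η'', ?_⟩
  rw [tateLocalMap_oneCocycleClass]
  congr 1
  apply Subtype.ext
  apply ContinuousMap.ext
  intro g
  apply Subtype.ext
  rw [pushCocycle_apply, coe_tateToTorsion_apply, hη''apply, hf''val, ← hkey g,
    show j + 1 + (k - j) = k + 1 by omega]

end Cartesian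

/-! ### §2 The short exact sequence `0 → E[p^j·p] → E[p^{j+n+1}·p] → E[p^n·p] → 0` and `H¹` -/

section SES

variable (W : WeierstrassCurve ℚ) [W.IsElliptic] (p : ℕ) [hp : Fact p.Prime] (j n : ℕ)
  (red : (W.torsionGaloisModule ((p : ℤ) ^ (j + n + 1) * (p : ℤ))).toContRepresentation →ⁱL
    (W.torsionGaloisModule ((p : ℤ) ^ n * (p : ℤ))).toContRepresentation)
  (hred : ∀ x : geomTorsion W ((p : ℤ) ^ (j + n + 1) * (p : ℤ)),
    ((red x : geomTorsion W ((p : ℤ) ^ n * (p : ℤ))) : geomPoints W) =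
      ((p : ℤ) ^ (j + 1)) • (x : geomPoints W))

omit hp in
/-- `p^j·p ∣ p^{j+n+1}·p` (the inclusion `E[p^{j+1}] ⊆ E[p^{j+n+2}]`, spelled by `pow_mul_dvd_pow_mul_of_le`).
[folklore] -/
theorem le_add_add_one : j ≤ j + n + 1 := by omega

omit [W.IsElliptic] in
include hred in
/-- **`0 → E[p^j·p] →(incl) E[p^{j+n+1}·p] →(red) E[p^n·p] → 0` is a short exact sequence of discrete
`Γ_ℚ`-modules** for any equivariant `red` acting as `x ↦ p^{j+1} x` on points (surjectivity = divisibility of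
`E(ℚ̄)`; n1011-p11 `TorsionLevel.isSES_torsionInclusion_red` is the case `j = 0`, `p = 3`).
[cite: MilneADT2006, Ch. I §6, proof of Prop. 6.9] -/
theorem isSES_torsionInclusion_red_add :
    IsSES (DiscreteGaloisModule.homOfIntertwining
        (W.torsionInclusion (pow_mul_dvd_pow_mul_of_le p (le_add_add_one j n))))
      (DiscreteGaloisModule.homOfIntertwining red) where
  comp_eq_zero := by
    ext P
    have h := (mem_geomTorsion_iff W ((p : ℤ) ^ j * (p : ℤ)) _).mp P.2
    change ((red (W.torsionInclusion (pow_mul_dvd_pow_mul_of_le p (le_add_add_one j n)) P) :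
      geomTorsion W ((p : ℤ) ^ n * (p : ℤ))) : geomPoints W) = 0
    rw [hred, coe_torsionInclusion_apply, pow_succ]
    exact h
  injective := fun P Q h => Subtype.ext (congrArg Subtype.val h :)
  exact_mid := fun P hP => by
    have hP' : ((p : ℤ) ^ j * (p : ℤ)) • (P : geomPoints W) = 0 := by
      rw [← pow_succ, ← hred]
      exact congrArg Subtype.val hP
    exact ⟨⟨P, (mem_geomTorsion_iff W _ _).mpr hP'⟩, rfl⟩
  surjective := fun Q => by
    have hp0 : ((p : ℤ) ^ (j + 1)) ≠ 0 := pow_ne_zero _ (Int.natCast_ne_zero.mpr hp.out.ne_zero)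
    obtain ⟨P, hP⟩ := W.zsmul_geomPoints_surjective_of_charZero hp0 (Q : geomPoints W)
    have hP' : ((p : ℤ) ^ (j + 1)) • P = (Q : geomPoints W) := hP
    have hPmem : P ∈ geomTorsion W ((p : ℤ) ^ (j + n + 1) * (p : ℤ)) := by
      rw [mem_geomTorsion_iff, show (p : ℤ) ^ (j + n + 1) * (p : ℤ) = ((p : ℤ) ^ n * (p : ℤ)) * (p : ℤ) ^ (j + 1)
        by ring, mul_zsmul, hP']
      exact (mem_geomTorsion_iff W _ _).mp Q.2
    refine ⟨⟨P, hPmem⟩, Subtype.ext ?_⟩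
    change ((red ⟨P, hPmem⟩ : geomTorsion W ((p : ℤ) ^ n * (p : ℤ))) : geomPoints W) = (Q : geomPoints W)
    rw [hred]
    exact hP'

omit [W.IsElliptic] in
include hred in
/-- **Exactness at `H¹(ℚ, E[p^{j+n+1}·p])`**: a class killed by `red_*` comes from `H¹(ℚ, E[p^j·p])`.
[cite: SerreGaloisCohomology1997, I §2.2] -/
theorem exists_map_torsionInclusion_eq_of_map_red_eq_zero_add
    (x : galoisCohomology (W.torsionGaloisModule ((p : ℤ) ^ (j + n + 1) * (p : ℤ))) 1)
    (hx : galoisCohomology.map red 1 x = 0) :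
    ∃ y, galoisCohomology.map (W.torsionInclusion (pow_mul_dvd_pow_mul_of_le p (le_add_add_one j n))) 1 y = x :=
  (isSES_torsionInclusion_red_add W p j n red hred).exists_map_one_eq_of_map_one_eq_zero x hx

omit [W.IsElliptic] in
include hred in
/-- **Local injectivity of `incl_* : H¹(ℚ_q, E[p^j·p]) → H¹(ℚ_q, E[p^{j+n+1}·p])`** at a prime `q` where
`#H⁰(ℚ_q, E[p^{j+n+1}·p]) = p^{j+n+2}`, `#H⁰(ℚ_q, E[p^n·p]) = p^{n+1}` and `#H⁰(ℚ_q, E[p^j·p]) = p^{j+1}`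
(a Kolyvagin prime of level `p^{j+n+2}`): the kernel is `δ₀(H⁰(ℚ_q, E[p^n·p]))` and `red` is ONTO on
invariants (its kernel injects into `H⁰(ℚ_q, E[p^j·p])`; counting `p^{j+n+2} = #range · #ker`).
n1011-p11's `localMap_torsionInclusion_injective` (the case `j = 0`, `p = 3`).
[cite: Rubin2011, Prop. 1.4.13 (1) (p. 9)] [cite: SerreGaloisCohomology1997, I §2.2] -/
theorem localMap_torsionInclusion_injective_add (q : HeightOneSpectrum (𝓞 ℚ))
    (hN : Nat.card (GaloisRep.toLocal q
      (W.torsionGaloisModule ((p : ℤ) ^ (j + n + 1) * (p : ℤ)))).toTopRep.ρ.invariants = p ^ (j + n + 2))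
    (hd : Nat.card (GaloisRep.toLocal q
      (W.torsionGaloisModule ((p : ℤ) ^ n * (p : ℤ)))).toTopRep.ρ.invariants = p ^ (n + 1))
    (hj : Nat.card (GaloisRep.toLocal q
      (W.torsionGaloisModule ((p : ℤ) ^ j * (p : ℤ)))).toTopRep.ρ.invariants = p ^ (j + 1)) :
    Function.Injective
      (localMap (W.torsionInclusion (pow_mul_dvd_pow_mul_of_le p (le_add_add_one j n))) (Sum.inr q)) := by
  set L := q.adicCompletion ℚ
  have hSES := (isSES_torsionInclusion_red_add W p j n red hred).restrictField L
  set ρN := GaloisRep.toLocal q (W.torsionGaloisModule ((p : ℤ) ^ (j + n + 1) * (p : ℤ))) with hρN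
  set ρd := GaloisRep.toLocal q (W.torsionGaloisModule ((p : ℤ) ^ n * (p : ℤ))) with hρd
  set ρ₃ := GaloisRep.toLocal q (W.torsionGaloisModule ((p : ℤ) ^ j * (p : ℤ))) with hρ₃
  set incl := W.torsionInclusion (pow_mul_dvd_pow_mul_of_le p (le_add_add_one j n)) with hincl
  have hppos : 0 < p := hp.out.pos
  haveI : Finite ρN.toTopRep.ρ.invariants :=
    Nat.finite_of_card_ne_zero (by rw [hN]; exact (pow_pos hppos _).ne')
  haveI : Finite ρd.toTopRep.ρ.invariants :=
    Nat.finite_of_card_ne_zero (by rw [hd]; exact (pow_pos hppos _).ne')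
  haveI : Finite ρ₃.toTopRep.ρ.invariants :=
    Nat.finite_of_card_ne_zero (by rw [hj]; exact (pow_pos hppos _).ne')
  -- `red` on invariants
  have hmem : ∀ w : ρN.toTopRep.ρ.invariants, red w.1 ∈ ρd.toTopRep.ρ.invariants := fun w σ => by
    have h := red.isIntertwining (absGaloisRestrict ℚ L σ) w.1
    change (W.torsionGaloisModule ((p : ℤ) ^ n * (p : ℤ))).toContRepresentation
      (absGaloisRestrict ℚ L σ) (red w.1) = red w.1
    rw [← h]
    exact congrArg red (w.2 σ)
  let r : ρN.toTopRep.ρ.invariants →+ ρd.toTopRep.ρ.invariants :=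
    { toFun := fun w => ⟨red w.1, hmem w⟩
      map_zero' := Subtype.ext (map_zero red)
      map_add' := fun a b => Subtype.ext (map_add red a.1 b.1) }
  -- the kernel of `r` injects into the invariants of `E[p^j·p]`
  have hker : Nat.card r.ker ≤ p ^ (j + 1) := by
    refine le_of_le_of_eq ?_ hj
    have hlift : ∀ w : r.ker, ∃ u : ρ₃.toTopRep.ρ.invariants, incl u.1 = w.1.1 := by
      intro w
      have hw0 : red w.1.1 = 0 := congrArg Subtype.val ((AddMonoidHom.mem_ker).mp w.2)
      obtain ⟨u, hu⟩ := (isSES_torsionInclusion_red_add W p j n red hred).exact_mid w.1.1 hw0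
      refine ⟨⟨u, fun σ => ?_⟩, hu⟩
      apply (isSES_torsionInclusion_red_add W p j n red hred).injective
      change incl ((W.torsionGaloisModule ((p : ℤ) ^ j * (p : ℤ))).toContRepresentation
        (absGaloisRestrict ℚ L σ) u) = incl u
      rw [incl.isIntertwining]
      have hw := w.1.2 σ
      change (W.torsionGaloisModule ((p : ℤ) ^ (j + n + 1) * (p : ℤ))).toContRepresentation
        (absGaloisRestrict ℚ L σ) w.1.1 = w.1.1 at hw
      rw [← hu] at hw
      exact hw
    choose lift hlift using hlift
    refine Nat.card_le_card_of_injective lift fun a b hab => ?_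
    apply Subtype.ext; apply Subtype.ext
    rw [← hlift a, ← hlift b, hab]
  -- counting
  have hcard : Nat.card ρN.toTopRep.ρ.invariants = Nat.card r.range * Nat.card r.ker := by
    rw [AddSubgroup.card_eq_card_quotient_mul_card_addSubgroup r.ker,
      Nat.card_congr (QuotientAddGroup.quotientKerEquivRange r).toEquiv]
  have hrange : Nat.card r.range = Nat.card ρd.toTopRep.ρ.invariants := by
    refine le_antisymm (AddSubgroup.card_le_card_addGroup r.range) ?_
    have h1 : Nat.card ρN.toTopRep.ρ.invariants = Nat.card r.range * Nat.card r.ker := hcard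
    rw [hN] at h1
    rw [hd]
    have h2 : p ^ (n + 1) * p ^ (j + 1) ≤ Nat.card r.range * p ^ (j + 1) :=
      calc p ^ (n + 1) * p ^ (j + 1) = p ^ (j + n + 2) := by rw [← pow_add]; congr 1; omega
        _ = Nat.card r.range * Nat.card r.ker := h1
        _ ≤ Nat.card r.range * p ^ (j + 1) := Nat.mul_le_mul_left _ hker
    exact Nat.le_of_mul_le_mul_right h2 (pow_pos hppos _)
  have hsurj : Function.Surjective r := by
    rw [← AddMonoidHom.range_eq_top, ← AddSubgroup.card_eq_iff_eq_top]
    exact hrange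
  -- `δ₀ = 0`, so `incl_*` is injective
  refine (injective_iff_map_eq_zero _).mpr fun x hx => ?_
  obtain ⟨v, hv⟩ := hSES.exists_δ₀_eq_of_map_one_eq_zero x hx
  obtain ⟨w, hw⟩ := hsurj v
  have hδ : hSES.δ₀ v = 0 :=
    (hSES.δ₀_eq_zero_iff v).mpr ⟨w.1, w.2, by rw [← hw]; rfl⟩
  exact hv.symm.trans hδ

/-- **Matched bases for the pair `(E[p^{j+n+1}·p], E[p^j·p])`**: some reduction `red' : E[p^{j+n+1}·p] →
E[p^j·p]` (`x ↦ p^{n+1} x`, `exists_torsionReduction_pow_mul`) carries a `ℤ/p^{j+n+2}`-basis to a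
`ℤ/p^{j+1}`-basis (part XVI `exists_bases_red_of_le`) — the input of the REFLECTION of the canonical comparison
maps along `incl : E[p^j·p] ↪ E[p^{j+n+1}·p]` (n1011-p15 F-B1b; replaces n1011-p11's `exists_bases_torsionMulBy`,
the case `j = 0`). [cite: SilvermanAEC2009, Cor. III.6.4(b)] -/
theorem exists_bases_red_top_to_sub :
    ∃ (red' : (W.torsionGaloisModule ((p : ℤ) ^ (j + n + 1) * (p : ℤ))).toContRepresentation →ⁱL
        (W.torsionGaloisModule ((p : ℤ) ^ j * (p : ℤ))).toContRepresentation)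
      (m : ℕ) (b : Basis (Fin m) (ZMod (p ^ (j + n + 1 + 1))) (geomTorsion W ((p : ℤ) ^ (j + n + 1) * (p : ℤ))))
      (b' : Basis (Fin m) (ZMod (p ^ (j + 1))) (geomTorsion W ((p : ℤ) ^ j * (p : ℤ)))),
      ∀ i, red' (b i) = b' i := by
  obtain ⟨red', hred'⟩ := exists_torsionReduction_pow_mul W p j (j + n + 1)
  obtain ⟨m, b, b', hb⟩ := exists_bases_red_of_le W p (le_add_add_one j n) red' hred'
  exact ⟨red', m, b, b', hb⟩

end SES

end Summit.BirchSwinnertonDyer.BirchSwinnertonDyer.Theorems.KimAtThreeD7uTamagawaSharp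

end
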